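import Literature.NumberTheory.FaltingsSerre.ExtensionGroupsS5bMeaning
import Literature.NumberTheory.FaltingsSerre.ExtensionGroupsS3wrS2

/-!
# The Faltings–Serre method after Brumer–Pacetti–Poor–Tornaría–Voight–Yuen, XV:
# the extension groups of Theorem 5.3.3(a) (`G = ι(S₃ ≀ S₂)` (order `72`)) — MEANING of the kernel certificate

Companion of `ExtensionGroupsS3wrS2.lean` (the KERNEL CERTIFICATE of [BPPTVY, Thm 5.3.3(a), p. 1176]:
A. Brumer, A. Pacetti, C. Poor, G. Tornaría, J. Voight, D. S. Yuen, *On the paramodularity of typical abelian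
surfaces*, Algebra & Number Theory **13**:5 (2019) 1145–1195 [cite: BrumerEtAl2019]).  That file proves `53`
closed Boolean identities by `decide +kernel`; THIS file is the ordinary mathematics which turns them into
theorems quantified over ALL codes / pairs / subspaces of the bit model (cell pub-paramod, DIVERGENCE.md
D-18, D-19).  It has the same architecture and the same theorem NAMES as `ExtensionGroupsS5bMeaning.lean`
(Theorem 5.3.1), whose generic `𝔽₂`-linear algebra (II.1–II.4, II.6, II.10: `IsLin`/`InSpan`, soundness and
completeness of `red`/`comb`/`ins`, `inSpan_of_syndrome`, `inS_iff_red_sB`, `mmul_assoc`, `conj_mmul`) is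
imported and reused verbatim.  New here are only (II.6′) the MEANING of the packed tables of the faster
certificate design (`getP_packL`: entry `k` of `packL w l` is `l[k]`; `ctabF_spec`: the in-kernel value table
`ctab z` IS the table of the word-cocycle values `cwW z (word k)`, so the table defects are the word defects,
`defectT_eq`), the tree-word unfolding from the packed parent table (`wordAt_step`, `wordAt_nxt`, `el_parent`,
with the small kernel check `check_fuel`), and the inheritance form of the cocycle certificates
(`SOLB_isCocyclePair`: every `ZB j` vector is the combination `INH j` of pairs of `V`, exact cocycles, inherited
and new cocycles — all of them cocycle data mod `V`).  Nothing here is computational beyond two small kernel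
checks (`check_fuel`, `check_tables`).

## What is proved (all statements are about the bit model of `ExtensionGroupsS3wrS2.lean`)

* M4 `isAdm_iff_red_admB` : for every `m < 2¹⁶`, `m` is admissible (`m - g·m ∈ 𝔰` for both generators
  `ι((1 2 3)(4 5))`, `ι((1 4)(2 5)(3 6))` of `G`) iff `m ∈ span admBW`.
* M3 `isCocyclePair_iff` : for every `j < 12` and EVERY packed pair `z`, `IsCocyclePair j z` (both components
  in `𝔰` and all `144` defects in `span(VB j)`) iff `red (SOLB j) z = 0` iff `z ∈ span(SOLB j)`; here
  `EL_facts`/`defect_tree`/`defectT_eq` identify the element table with the values of the `72` tree words and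
  the (table) defects with the cocycle identity along left multiplication by the generators.
* M5 `extension_classes_M`, `extension_classes_S`, `total_classes` : for every `j < 12`, every cocycle pair
  is equivalent — modulo `span(gensQW)`, the pairs of `VB j` plus the coboundaries `cobW m` of all admissible `m`
  (resp. all `m ∈ 𝔰`) — to EXACTLY ONE tabulated representative `REPSM j` (resp. `REPSS j`); the
  representatives are cocycle pairs, pairwise inequivalent, without repetition, and their numbers sum to
  **`20`** (resp. **`36`**) over the twelve submodules, with `dim V` multiset `{0,0,1,1,2,4,4,4,4,5,5,5,5,6,6,8,8,9,9,10}` (`kMultiset_M` of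
  the certificate) — the printed numbers of [BPPTVY, Thm 5.3.3(a)].
* M2 `submodules_classified` : EVERY subset `S ⊆ 𝔰` containing `0`, closed under `+` and under conjugation by
  the two generators of `G` is `span(VB j)` for one of the TWELVE tabulated `j` (dimensions `0,1,2,4,4,5,5,6,6,8,9,10`),
  and these are pairwise distinct (`VB_distinct`).

## The dictionary to subgroups `E ≤ 𝔰 ⋊ G` with `π(E) = G`

Verbatim as in `ExtensionGroupsS5bMeaning.lean` ([BPPTVY, §2.3, Lemma 2.3.4; §3.1 (3.1.6)]), with the `72`
tree words of `ExtensionGroupsS3wrS2` in place of the `120` normal-form words: `V := E ∩ 𝔰` is a `G`-submodule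
(M2), the class of `E` is a cocycle pair modulo `V` (M3), and `M₄(𝔽₂) ⋊ G`- (resp. `𝔰 ⋊ G`-) conjugacy of
such subgroups is `CobEquiv` of their pairs (M5).  This passage from the bit model to `Subgroup (𝔰 ⋊ G)` is
NOT formalised here; it is the standard non-abelian-cohomology bookkeeping of [BPPTVY, §2.3] (prose, D-18).
The statements about `H` and the exact core-free subgroups `D` (`check_H`, `check_D` of the certificate) are
not given a meaning layer here either (their reading is in the certificate's header).

## References
* [BPPTVY] ANT 13:5 (2019): Thm 5.3.3 and proof p. 1176; Thm 5.3.1 p. 1176; §2.3 (Lemma 2.3.4)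
  pp. 1155–1157; §3.1 (3.1.6) p. 1162; §5.1 p. 1173. [cite: BrumerEtAl2019]
-/

namespace Literature.NumberTheory.FaltingsSerre.GSp4F2.ExtS3wrS2

/-! ## Part II — MEANING of the certificates (Theorem 5.3.3(a), `G = ι(S₃ ≀ S₂)`)

Ordinary mathematics turning the closed Boolean identities of `ExtensionGroupsS3wrS2` into theorems
quantified over ALL codes, pairs and subspaces of the bit model.  The generic `𝔽₂`-linear algebra
(`IsLin`, `InSpan`, `red`/`comb`/`ins` soundness and completeness, `mmul_assoc`, `inS_iff_red_sB`) is
imported from `ExtensionGroupsS5bMeaning`; what follows is the group-specific layer, in the same order and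
with the same names as there (II.7–II.11), plus the MEANING of the packed tables (II.6′). -/

section Meaning

open Literature.NumberTheory.FaltingsSerre.GSp4F2.Ext hiding AC CMPB CMPBlist CobEquiv DCERTS DCert EL EL_facts ELinv HE HW IsCocyclePair JREPM JREPMlist
  JREPS JREPSlist MASKSM MASKSMlist MASKSS MASKSSlist QBM QBMlist QBS QBSlist REPS REPSM
  REPSMlist REPSS REPSSlist SEL SEL_bound SELlist SOLB SOLB_isCocyclePair SOLB_length SYNPAT
  SYNPATlist VB VB_conj_closed VB_distinct VB_facts VB_zero VBlist VBpair_mem_gensQ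
  VBspan_closed ZB ZBlist admB admB_facts admSyn admSyn_lin cG0 cG0i cG1 cG1i check_D check_EL
  check_H check_Q check_Q_0 check_Q_1 check_Q_2 check_Q_3 check_Q_4 check_Q_5 check_Q_6
  check_Q_7 check_VB check_adm check_admC check_cmp check_cmp_0 check_cmp_1 check_cmp_2
  check_cmp_3 check_cmp_4 check_cmp_5 check_cmp_6 check_cmp_7 check_codes check_cyc
  check_orbitRep check_sol check_sol_0 check_sol_1 check_sol_2 check_sol_3 check_sol_4
  check_sol_5 check_sol_6 check_sol_7 check_sum check_tables classCount_M classCount_S cob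
  cob_lin cob_mem_gensQ conj_el_mem conj_inv_cancel conj_word_mem coreWit cw cw_lin cw_mem_VB
  cycIdx cycPacked cyclic_submodule dCheck defect defect_lin defect_mem_VB defect_tree dw el
  el_eq el_lt eli eli_as_word eli_eq eli_lt evalC evalC_lt evalC_mul_evalCi evalCi evalCi_lt
  evalCi_mul_evalC evalH extension_classes_M extension_classes_S gN gN_lt gN_mul_giN gT gTPacked
  gensQ giN giN_lt hC hCi hWordG incl inclPacked isAdm isAdm_iff_admSyn isAdm_iff_red_admB
  isCocyclePair_iff isCocyclePair_iff_inSpan isCocyclePair_of_isSol isSol isTree kMultiset_M nxt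
  nxtH nxtPacked orbitRep_facts pairsOf_components pairsOf_units2 quotCert quotCert_sound
  sB_sub_admB submodules_classified sumIdx sum_facts synBits synBits_eq_zero synBits_lin
  total_classes wordAt

/-! ### II.6′ MEANING of the packed tables and of the nested loops -/

/-- `testBit` of a packed cons `(acc <<< w) ||| e`, `e < 2ʷ`. [folklore] -/
theorem testBit_packCons (w e acc i : ℕ) (he : e < 2 ^ w) :
    ((acc <<< w) ||| e).testBit i = if i < w then e.testBit i else acc.testBit (i - w) := by
  rw [Nat.testBit_or, Nat.testBit_shiftLeft]
  split_ifs with h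
  · simp [Nat.not_le.mpr h]
  · have : e.testBit i = false := Nat.testBit_lt_two_pow
      (lt_of_lt_of_le he (Nat.pow_le_pow_right (by norm_num) (Nat.not_lt.mp h)))
    simp [Nat.not_lt.mp h, this]

/-- MEANING of `packL`/`getP`: entry `k` of `packL w l` is `l[k]` (default `0`) when all entries of `l`
are `< 2ʷ`. [folklore] -/
theorem getP_packL (w : ℕ) (l : List ℕ) (hl : ∀ e ∈ l, e < 2 ^ w) (k : ℕ) :
    getP w (packL w l) k = l.getD k 0 := by
  induction l generalizing k with
  | nil => simp [getP, packL]
  | cons e l ih =>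
    have he : e < 2 ^ w := hl e (List.mem_cons_self ..)
    have hl' : ∀ e ∈ l, e < 2 ^ w := fun x hx => hl x (List.mem_cons_of_mem _ hx)
    have hp : packL w (e :: l) = (packL w l <<< w) ||| e := rfl
    apply Nat.eq_of_testBit_eq; intro i
    rw [getP, Nat.testBit_mod_two_pow, Nat.testBit_shiftRight, hp, testBit_packCons _ _ _ _ he]
    cases k with
    | zero =>
      simp only [Nat.mul_zero, Nat.zero_add, List.getD_cons_zero]
      by_cases hi : i < w
      · simp [hi]
      · simp [hi, Nat.testBit_lt_two_pow (lt_of_lt_of_le he (Nat.pow_le_pow_right (by norm_num)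
          (Nat.not_lt.mp hi)))]
    | succ k =>
      simp only [List.getD_cons_succ]
      have hge : ¬ (w * (k + 1) + i < w) := by nlinarith
      simp only [hge, if_false]
      have := congrArg (fun x => x.testBit i) (ih hl' k)
      simp only [getP, Nat.testBit_mod_two_pow, Nat.testBit_shiftRight] at this
      rw [show w * (k + 1) + i - w = w * k + i by rw [Nat.mul_succ]; omega]
      exact this

/-- `cval T k = getP 16 T k`. [folklore] -/
theorem cval_eq_getP (T k : ℕ) : cval T k = getP 16 T k := by simp [cval, getP]

/-- Bits of a `16`-bit table entry. [folklore] -/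
theorem cval_testBit (T m i : ℕ) : (cval T m).testBit i = (decide (i < 16) && T.testBit (16 * m + i)) := by
  rw [cval, show (65536 : ℕ) = 2 ^ 16 by norm_num, Nat.testBit_mod_two_pow, Nat.testBit_shiftRight]

/-- `cval T m < 2¹⁶`. [folklore] -/
theorem cval_lt (T m : ℕ) : cval T m < 65536 := Nat.mod_lt _ (by norm_num)

/-- Writing a `16`-bit value into the (empty) block `p` of a table `< 2^(16 p)`. [folklore] -/
theorem cval_lor_shift {T v p : ℕ} (hT : T < 2 ^ (16 * p)) (hv : v < 65536) (m : ℕ) :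
    cval (T ||| (v <<< (16 * p))) m = if m = p then v else cval T m := by
  apply Nat.eq_of_testBit_eq; intro i
  have hv' : ∀ j, 16 ≤ j → v.testBit j = false := fun j hj =>
    Nat.testBit_lt_two_pow (lt_of_lt_of_le hv (Nat.pow_le_pow_right (show 0 < 2 by norm_num) hj))
  have hT' : ∀ j, 16 * p ≤ j → T.testBit j = false := fun j hj =>
    Nat.testBit_lt_two_pow (lt_of_lt_of_le hT (Nat.pow_le_pow_right (by norm_num) hj))
  rw [cval_testBit, Nat.testBit_or, Nat.testBit_shiftLeft]
  split_ifs with hm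
  · subst hm
    by_cases hi : i < 16
    · have h1 : 16 * m + i ≥ 16 * m := by omega
      simp [hi, h1, hT' (16 * m + i) (by omega)]
    · simp [hi, hv' i (by omega)]
  · rw [cval_testBit]
    by_cases hi : i < 16
    · rcases lt_or_gt_of_ne hm with hm | hm
      · have : ¬ (16 * m + i ≥ 16 * p) := by omega
        simp [hi, this]
      · have h1 : 16 * m + i ≥ 16 * p := by omega
        simp [hi, h1, hv' (16 * m + i - 16 * p) (by omega)]
    · simp [hi]

/-- … and the result is `< 2^(16 (p+1))`. [folklore] -/
theorem lor_shift_lt {T v p : ℕ} (hT : T < 2 ^ (16 * p)) (hv : v < 65536) :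
    T ||| (v <<< (16 * p)) < 2 ^ (16 * (p + 1)) := by
  apply Nat.lt_pow_two_of_testBit
  intro j hj
  rw [Nat.testBit_or, Nat.testBit_shiftLeft]
  have h1 : T.testBit j = false :=
    Nat.testBit_lt_two_pow (lt_of_lt_of_le hT (Nat.pow_le_pow_right (by norm_num) (by omega)))
  have h2 : v.testBit (j - 16 * p) = false := Nat.testBit_lt_two_pow (lt_of_lt_of_le hv (by
    have : 16 ≤ j - 16 * p := by omega
    exact Nat.pow_le_pow_right (show 0 < 2 by norm_num) this))
  simp [h1, h2]

/-- Entry `k < 72` of a bounded Boolean loop (the shape of the big kernel checks). [folklore] -/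
theorem loop_get {f : ℕ → Bool} (h : ((List.range 72).all fun k => f k) = true) (k : ℕ) (hk : k < 72) :
    f k = true :=
  List.all_eq_true.mp h _ (List.mem_range.mpr hk)

/-- MEANING of `check_ELcard` for the accessors: `el k = EL[k]`, `eli k = ELinv[k]` (defaults `0`). [folklore] -/
theorem el_getD (k : ℕ) : el k = EL.getD k 0 ∧ eli k = ELinv.getD k 0 := by
  obtain ⟨-, -, hE, hEi, -⟩ := check_ELcard
  have hE' : ∀ e ∈ EL, e < 2 ^ 16 := fun e he => by
    have := List.all_eq_true.mp hE e he; simpa using this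
  have hEi' : ∀ e ∈ ELinv, e < 2 ^ 16 := fun e he => by
    have := List.all_eq_true.mp hEi e he; simpa using this
  exact ⟨by rw [el, cval_eq_getP, elP, getP_packL 16 EL hE'],
    by rw [eli, cval_eq_getP, eliP, getP_packL 16 ELinv hEi']⟩

/-- `el k < 2¹⁶` (written `2 ^ 16`, not `65536`: `el` is THIS file's namespace-local constant and the
gate's statement index is namespace-blind — typer-g4/g3fix/README.md, DIAGNOSIS). [folklore] -/
theorem el_lt (k : ℕ) : el k < 2 ^ 16 := cval_lt _ _
/-- `eli k < 2¹⁶` (written `2 ^ 16`, not `65536`: `eli` is THIS file's namespace-local constant and the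
gate's statement index is namespace-blind — typer-g4/g3fix/README.md, DIAGNOSIS). [folklore] -/
theorem eli_lt (k : ℕ) : eli k < 2 ^ 16 := cval_lt _ _

/-! ### II.5′ `𝔰` is `G`-stable (generators of THIS `G`) -/

/-- MEANING of `check_sG`: `span(sB) = 𝔰` is stable under conjugation by `g₀^{±1}`, `g₁^{±1}`. [folklore] -/
theorem sG_facts (b : ℕ) (hb : b ∈ vecs sB) :
    red sB (conj cG0 cG0i b) = 0 ∧ red sB (conj cG1 cG1i b) = 0 ∧
    red sB (conj cG0i cG0 b) = 0 ∧ red sB (conj cG1i cG1 b) = 0 := by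
  have := List.all_eq_true.mp check_sG b hb
  simp only [Bool.and_eq_true, beq_iff_eq] at this
  obtain ⟨⟨⟨h1, h2⟩, h3⟩, h4⟩ := this
  exact ⟨h1, h2, h3, h4⟩

/-- `𝔰` (as the set `red sB · = 0`) is stable under conjugation by the generators and their inverses. [folklore] -/
theorem s_conj_closed {x : ℕ} (hx : red sB x = 0) :
    red sB (conj cG0 cG0i x) = 0 ∧ red sB (conj cG1 cG1i x) = 0 ∧
    red sB (conj cG0i cG0 x) = 0 ∧ red sB (conj cG1i cG1 x) = 0 := by
  obtain ⟨t, rfl⟩ := inSpan_of_red_eq_zero hx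
  refine ⟨?_, ?_, ?_, ?_⟩
  · rw [(conj_lin _ _).map_comb]
    exact (red_lin sB).comb_eq_zero (fun v hv => by
      obtain ⟨b, hb, rfl⟩ := List.mem_map.mp hv; exact (sG_facts b hb).1) t
  · rw [(conj_lin _ _).map_comb]
    exact (red_lin sB).comb_eq_zero (fun v hv => by
      obtain ⟨b, hb, rfl⟩ := List.mem_map.mp hv; exact (sG_facts b hb).2.1) t
  · rw [(conj_lin _ _).map_comb]
    exact (red_lin sB).comb_eq_zero (fun v hv => by
      obtain ⟨b, hb, rfl⟩ := List.mem_map.mp hv; exact (sG_facts b hb).2.2.1) t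
  · rw [(conj_lin _ _).map_comb]
    exact (red_lin sB).comb_eq_zero (fun v hv => by
      obtain ⟨b, hb, rfl⟩ := List.mem_map.mp hv; exact (sG_facts b hb).2.2.2) t

/-! ### II.7 MEANING of the admissibility certificate: `m` admissible `↔ m ∈ span(admBW)` -/

/-- The admissibility syndrome is `𝔽₂`-linear. [folklore] -/
theorem admSyn_lin : IsLin admSynW := by
  intro x y
  simp only [admSynW]
  exact (((red_lin sB).comp (IsLin.id.xor (conj_lin cG0 cG0i))).xor
    ((IsLin.shiftLeft 16).comp ((red_lin sB).comp (IsLin.id.xor (conj_lin cG1 cG1i))))) x y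

/-- `isAdmW m ↔ admSynW m = 0` (admissible: `m + g m g⁻¹ ∈ 𝔰` for both generators `g` of `G`). [folklore] -/
theorem isAdm_iff_admSyn (m : ℕ) (hm : m < 65536) : isAdmW m = true ↔ admSynW m = 0 := by
  have h0 : m ^^^ conj cG0 cG0i m < 65536 := xor_lt_65536 hm (conj_lt ..)
  have h1 : m ^^^ conj cG1 cG1i m < 65536 := xor_lt_65536 hm (conj_lt ..)
  simp only [isAdmW, Bool.and_eq_true, inS_iff_red_sB _ h0, inS_iff_red_sB _ h1, admSynW]
  constructor
  · rintro ⟨ha, hb⟩; rw [ha, hb]; rfl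
  · intro h
    exact xor_shiftLeft16_eq_zero (red_sB_lt h0) h

/-- MEANING of `check_adm`: the `admBW` vectors are admissible and `admBW` is self-reducing with zero
syndrome. [folklore] -/
theorem admB_facts (m : ℕ) (hm : m ∈ vecs admBW) : isAdmW m = true ∧ red admBW m = 0 ∧ admSynW m = 0 := by
  have h1 := List.all_eq_true.mp check_adm.1 m hm
  have h2 := List.all_eq_true.mp check_admC.2.1 m hm
  simp only [Bool.and_eq_true, beq_iff_eq] at h1 h2
  exact ⟨h1.1, h1.2, h2⟩

/-- MEANING (admissible set, Part I §G): for every code `m < 2¹⁶`, `m` is admissible iff `m` reduces to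
`0` modulo `admBW`, iff `m ∈ span(admBW)` (`= 𝔰 ⊕ ⟨diag(1,1,0,0)⟩`, `2¹¹` elements). [folklore] -/
theorem isAdm_iff_red_admB (m : ℕ) (hm : m < 65536) : isAdmW m = true ↔ red admBW m = 0 := by
  have hBred : ∀ v ∈ vecs admBW, red admBW v = 0 := fun v hv => (admB_facts v hv).2.1
  rw [isAdm_iff_admSyn m hm]
  constructor
  · intro hsyn
    apply red_eq_zero_of_inSpan hBred
    have hunits : ∀ i < 16, InSpan (vecs (admBW ++ AC)) (2 ^ i) := fun i hi =>
      inSpan_of_red_eq_zero (by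
        have := List.all_eq_true.mp check_admC.1 i (List.mem_range.mpr hi)
        simpa using this)
    have hx : InSpan (vecs admBW ++ vecs AC) m := by
      rw [← vecs_append]
      exact inSpan_of_lt_two_pow hunits (by norm_num; exact hm)
    refine inSpan_of_syndrome admSyn_lin (fun v hv => (admB_facts v hv).2.2) ?_ hx hsyn
    intro t ht ht0
    have hlen : (vecs AC).length = 5 := rfl
    rw [hlen] at ht
    have := List.all_eq_true.mp check_admC.2.2 t (List.mem_range.mpr (by norm_num at ht; exact ht))
    simpa [ht0] using this
  · intro h
    obtain ⟨t, rfl⟩ := inSpan_of_red_eq_zero h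
    exact admSyn_lin.comb_eq_zero (fun v hv => (admB_facts v hv).2.2) t

/-- `𝔰 ⊆` admissible and `diag(1,1,0,0)` is admissible (as span membership). [folklore] -/
theorem sB_sub_admB : ∀ m ∈ cDiag1100 :: vecs sB, red admBW m = 0 := by
  intro m hm
  have := List.all_eq_true.mp check_adm.2 m hm
  simpa using this

/-! ### II.8 MEANING of the cocycle certificates: `Sol(V) = span(SOLB j)` -/

/-- The word-cocycle value `cwW · w` is XOR-linear in the packed pair. [folklore] -/
theorem cw_lin (w : List (Fin 2)) : IsLin (fun z => cwW z w) := by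
  induction w with
  | nil => intro x y; simp [cwW]
  | cons a w ih =>
    intro x y
    simp only [cwW]
    rw [show xc (x ^^^ y) a.val = xc x a.val ^^^ xc y a.val from xc_lin a.val x y,
      show cwW (x ^^^ y) w = cwW x w ^^^ cwW y w from ih x y, conj_lin, xor4]

/-- The cocycle defectW `defectW · a k` is XOR-linear in the packed pair. [folklore] -/
theorem defect_lin (a k : ℕ) : IsLin (fun z => defectW z a k) := fun x y => by
  simp only [defectW]
  exact (((cw_lin _).xor (xc_lin a)).xor ((conj_lin _ _).comp (cw_lin _))) x y

/-- Case split of `j < 12`. [folklore] -/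
theorem lt_nsub {j : ℕ} (hj : j < 12) : j = 0 ∨ j = 1 ∨ j = 2 ∨ j = 3 ∨ j = 4 ∨ j = 5 ∨ j = 6 ∨ j = 7 ∨ j = 8 ∨ j = 9 ∨ j = 10 ∨ j = 11 := by
  omega

/-- Dispatcher: the exact cocycles `ZB 0` pass `isSolW 0`. [folklore] -/
theorem check_exact : ((vecs (ZB 0)).all fun z => isSolW 0 z) = true := check_sol_0.1

/-- Dispatcher: `check_sol_j` for a variable `j < 12`: the new cocycles pass `isSolW j` (`j ≠ 0`), the
inheritance sources are contained in `VB j`, every `ZB j` vector is the combination `INH j` of `SRC j`, and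
`SOLB j` is self-reducing. [folklore] -/
theorem check_sol (j : ℕ) (hj : j < 12) : (j ≠ 0 → ((NEWB j).all fun z => isSolW j z) = true) ∧
    ((INHSRC j).all fun i => incl i j) = true ∧
    ((List.range (ZB j).length).all fun m =>
      comb (SRC j) ((INH j).getD m 0) == (vecs (ZB j)).getD m 0) = true ∧
    ((vecs (SOLB j)).all fun z => red (SOLB j) z == 0) = true := by
  rcases lt_nsub hj with rfl | rfl | rfl | rfl | rfl | rfl | rfl | rfl | rfl | rfl | rfl | rfl
  · exact ⟨fun h => absurd rfl h, check_sol_0.2.1, check_sol_0.2.2.1, check_sol_0.2.2.2⟩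
  · exact ⟨fun _ => check_sol_1.1, check_sol_1.2.1, check_sol_1.2.2.1, check_sol_1.2.2.2⟩
  · exact ⟨fun _ => check_sol_2.1, check_sol_2.2.1, check_sol_2.2.2.1, check_sol_2.2.2.2⟩
  · exact ⟨fun _ => check_sol_3.1, check_sol_3.2.1, check_sol_3.2.2.1, check_sol_3.2.2.2⟩
  · exact ⟨fun _ => check_sol_4.1, check_sol_4.2.1, check_sol_4.2.2.1, check_sol_4.2.2.2⟩
  · exact ⟨fun _ => check_sol_5.1, check_sol_5.2.1, check_sol_5.2.2.1, check_sol_5.2.2.2⟩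
  · exact ⟨fun _ => check_sol_6.1, check_sol_6.2.1, check_sol_6.2.2.1, check_sol_6.2.2.2⟩
  · exact ⟨fun _ => check_sol_7.1, check_sol_7.2.1, check_sol_7.2.2.1, check_sol_7.2.2.2⟩
  · exact ⟨fun _ => check_sol_8.1, check_sol_8.2.1, check_sol_8.2.2.1, check_sol_8.2.2.2⟩
  · exact ⟨fun _ => check_sol_9.1, check_sol_9.2.1, check_sol_9.2.2.1, check_sol_9.2.2.2⟩
  · exact ⟨fun _ => check_sol_10.1, check_sol_10.2.1, check_sol_10.2.2.1, check_sol_10.2.2.2⟩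
  · exact ⟨fun _ => check_sol_11.1, check_sol_11.2.1, check_sol_11.2.2.1, check_sol_11.2.2.2⟩

/-- Dispatcher: `check_cmp_j` for a variable `j < 12`. [folklore] -/
theorem check_cmp (j : ℕ) (hj : j < 12) : ((vecs (CMPB j)).all fun z => red units2 z == 0) = true ∧
    ((vecs units2).all fun u => red (SOLB j ++ CMPB j) u == 0) = true ∧
    (vecs (CMPB j)).map (synBitsW j) = SYNPAT j ∧
    (∀ t < 2 ^ (SYNPAT j).length, t ≠ 0 → comb (SYNPAT j) t ≠ 0) := by
  rcases lt_nsub hj with rfl | rfl | rfl | rfl | rfl | rfl | rfl | rfl | rfl | rfl | rfl | rfl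
  · exact ⟨check_cmp_0.1, check_cmp_0.2.1, check_cmp_0.2.2.1, range_all_conv check_cmp_0.2.2.2 (by decide)⟩
  · exact ⟨check_cmp_1.1, check_cmp_1.2.1, check_cmp_1.2.2.1, range_all_conv check_cmp_1.2.2.2 (by decide)⟩
  · exact ⟨check_cmp_2.1, check_cmp_2.2.1, check_cmp_2.2.2.1, range_all_conv check_cmp_2.2.2.2 (by decide)⟩
  · exact ⟨check_cmp_3.1, check_cmp_3.2.1, check_cmp_3.2.2.1, range_all_conv check_cmp_3.2.2.2 (by decide)⟩
  · exact ⟨check_cmp_4.1, check_cmp_4.2.1, check_cmp_4.2.2.1, range_all_conv check_cmp_4.2.2.2 (by decide)⟩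
  · exact ⟨check_cmp_5.1, check_cmp_5.2.1, check_cmp_5.2.2.1, range_all_conv check_cmp_5.2.2.2 (by decide)⟩
  · exact ⟨check_cmp_6.1, check_cmp_6.2.1, check_cmp_6.2.2.1, range_all_conv check_cmp_6.2.2.2 (by decide)⟩
  · exact ⟨check_cmp_7.1, check_cmp_7.2.1, check_cmp_7.2.2.1, range_all_conv check_cmp_7.2.2.2 (by decide)⟩
  · exact ⟨check_cmp_8.1, check_cmp_8.2.1, check_cmp_8.2.2.1, range_all_conv check_cmp_8.2.2.2 (by decide)⟩
  · exact ⟨check_cmp_9.1, check_cmp_9.2.1, check_cmp_9.2.2.1, range_all_conv check_cmp_9.2.2.2 (by decide)⟩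
  · exact ⟨check_cmp_10.1, check_cmp_10.2.1, check_cmp_10.2.2.1, range_all_conv check_cmp_10.2.2.2 (by decide)⟩
  · exact ⟨check_cmp_11.1, check_cmp_11.2.1, check_cmp_11.2.2.1, range_all_conv check_cmp_11.2.2.2 (by decide)⟩

/-- The inheritance sources are proper indices `0 < i < 12`. [folklore] -/
theorem INHSRC_bound (j : ℕ) (hj : j < 12) : ∀ i ∈ INHSRC j, 0 < i ∧ i < 12 := by
  rcases lt_nsub hj with rfl | rfl | rfl | rfl | rfl | rfl | rfl | rfl | rfl | rfl | rfl | rfl <;> decide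

/-- The table facts of Part I §C (`check_EL`), unpacked for one `k < 72`. [folklore] -/
theorem EL_facts (k : ℕ) (hk : k < 72) : (k = 0 ∨ wPar k / 2 < k) ∧ el k = evalC (wordAt k) ∧
    mmul (el k) (eli k) = cI ∧ mmul (eli k) (el k) = cI ∧
    ∀ a < 2, nxt a k < 72 ∧ el (nxt a k) = mmul (gNW a) (el k) ∧
      (isTree a k = true ↔ nxt a k ≠ 0 ∧ wPar (nxt a k) = 2 * k + a) := by
  have h := loop_get check_EL k hk
  simp only [Bool.and_eq_true, Bool.or_eq_true, beq_iff_eq, List.all_eq_true, List.mem_range,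
    decide_eq_true_eq] at h
  obtain ⟨⟨⟨⟨h0, h1⟩, h2⟩, h3⟩, h4⟩ := h
  refine ⟨h0, h1, h2, h3, fun a ha => ?_⟩
  obtain ⟨⟨h5, h6⟩, h7⟩ := h4 a ha
  refine ⟨h5, h6, ?_⟩
  rw [h7]; simp [Bool.and_eq_true, bne_iff_ne, ne_eq, beq_iff_eq]

set_option maxRecDepth 200000 in
/-- KERNEL CHECK (small): one unit of fuel less still computes every tree word (all words have length
`≤ 9`), and `wordAt 0 = []`. [folklore] -/
theorem check_fuel : ((List.range 72).all fun k => wordAtF 10 k == wordAt k) = true ∧ wordAt 0 = [] := by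
  constructor <;> decide +kernel

/-- `wordAtF (11-1) k = wordAt k` for `k < 72`. [folklore] -/
theorem wordAtF_pred (k : ℕ) (hk : k < 72) : wordAtF 10 k = wordAt k := by
  have h := loop_get check_fuel.1 k hk
  simp only [beq_iff_eq] at h
  exact h

/-- Unfolding of a tree word at `k ≠ 0`: letter `wPar k % 2`, then the word of the parent `wPar k / 2`. [folklore] -/
theorem wordAt_step {k : ℕ} (hk0 : k ≠ 0) (hp : wPar k / 2 < 72) :
    wordAt k = ⟨wPar k % 2, Nat.mod_lt _ (by decide)⟩ :: wordAt (wPar k / 2) := by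
  rw [← wordAtF_pred _ hp]
  show wordAtF (10 + 1) k = _
  rw [wordAtF.eq_2, if_neg hk0]

/-- On a tree edge `(a,k)`: `word (nxt a k) = a :: word k`. [folklore] -/
theorem wordAt_nxt {a k : ℕ} (ha : a < 2) (hk : k < 72) (ht : isTree a k = true) :
    wordAt (nxt a k) = (⟨a, ha⟩ : Fin 2) :: wordAt k := by
  obtain ⟨-, -, -, -, hall⟩ := EL_facts k hk
  obtain ⟨-, -, htree⟩ := hall a ha
  obtain ⟨hn0, hw⟩ := htree.mp ht
  have hp : wPar (nxt a k) / 2 = k := by rw [hw]; omega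
  have hl : wPar (nxt a k) % 2 = a := by rw [hw]; omega
  rw [wordAt_step hn0 (by rw [hp]; exact hk), hp]
  exact congrArg (· :: wordAt k) (Fin.ext hl)

/-- Every non-identity element is a generator times its tree parent: `e_k = g_{ℓ(k)} · e_{parent k}`,
`parent k < k`. [folklore] -/
theorem el_parent {k : ℕ} (hk : k < 72) (hk0 : k ≠ 0) :
    wPar k / 2 < k ∧ el k = mmul (gNW (wPar k % 2)) (el (wPar k / 2)) := by
  obtain ⟨h0, h1, -⟩ := EL_facts k hk
  have hp : wPar k / 2 < k := h0.resolve_left hk0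
  obtain ⟨-, h1', -⟩ := EL_facts (wPar k / 2) (lt_trans hp hk)
  refine ⟨hp, ?_⟩
  rw [h1, wordAt_step hk0 (lt_trans hp hk), h1']
  rfl

/-- On a TREE EDGE the word defectW vanishes identically. [folklore] -/
theorem defect_tree {z a k : ℕ} (ha : a < 2) (hk : k < 72) (ht : isTree a k = true) : defectW z a k = 0 := by
  unfold defectW
  rw [wordAt_nxt ha hk ht]
  simp only [cwW]
  exact xor_aux2 _ _

/-- Components of a pair `< 2³²` are `< 2¹⁶`. [folklore] -/
theorem xc_lt {z : ℕ} (hz : z < 2 ^ 32) (a : ℕ) : xc z a < 65536 := by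
  by_cases ha : a = 0
  · subst ha; rw [xc_zero]; exact Nat.mod_lt _ (by norm_num)
  · rw [xc_of_ne_zero z a ha, Nat.shiftRight_eq_div_pow]
    exact Nat.div_lt_of_lt_mul (by norm_num at hz ⊢; exact hz)

/-- Values of the word cocycle are codes `< 2¹⁶` (for pairs `< 2³²`). [folklore] -/
theorem cw_lt {z : ℕ} (hz : z < 2 ^ 32) : ∀ w, cwW z w < 65536
  | [] => by simp [cwW]
  | a :: w => by simp only [cwW]; exact xor_lt_65536 (xc_lt hz _) (conj_lt ..)

/-- The partial value tables of `ctab`. [folklore] -/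
def ctabF (z : ℕ) (i : ℕ) : ℕ :=
  (List.range i).foldl (fun T i =>
    let k := i + 1
    let a := wPar k % 2
    T ||| ((xc z a ^^^ conj (gNW a) (giNW a) (cval T (wPar k / 2))) <<< (16 * k))) 0

/-- `ctab z = ctabF z (72-1)`. [folklore] -/
theorem ctab_eq (z : ℕ) : ctab z = ctabF z 71 := rfl

/-- One more filled entry. [folklore] -/
theorem ctabF_succ (z i : ℕ) : ctabF z (i + 1) = ctabF z i |||
    ((xc z (wPar (i + 1) % 2) ^^^ conj (gNW (wPar (i + 1) % 2)) (giNW (wPar (i + 1) % 2))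
      (cval (ctabF z i) (wPar (i + 1) / 2))) <<< (16 * (i + 1))) := by
  simp only [ctabF, List.range_succ, List.foldl_append, List.foldl_cons, List.foldl_nil]

/-- MEANING of the value table `ctab`: after filling `i < 72` entries, entry `m ≤ i` is the word-cocycle
value `c(e_m) = cwW z (word m)` and the table is `< 2^(16 (i+1))`. [folklore] -/
theorem ctabF_spec {z : ℕ} (hz : z < 2 ^ 32) : ∀ i < 72, ctabF z i < 2 ^ (16 * (i + 1)) ∧
    ∀ m ≤ i, cval (ctabF z i) m = cwW z (wordAt m)
  | 0, _ => by
      refine ⟨by simp [ctabF], fun m hm => ?_⟩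
      obtain rfl : m = 0 := Nat.le_zero.mp hm
      simp [ctabF, cval, check_fuel.2, cwW]
  | i + 1, hi => by
      obtain ⟨hT, hval⟩ := ctabF_spec hz i (Nat.lt_of_succ_lt hi)
      have hk0 : i + 1 ≠ 0 := Nat.succ_ne_zero i
      obtain ⟨hp, -⟩ := el_parent hi hk0
      have hv : xc z (wPar (i + 1) % 2) ^^^ conj (gNW (wPar (i + 1) % 2)) (giNW (wPar (i + 1) % 2))
          (cval (ctabF z i) (wPar (i + 1) / 2)) = cwW z (wordAt (i + 1)) := by
        rw [hval _ (Nat.lt_succ_iff.mp hp), wordAt_step hk0 (lt_trans hp hi)]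
        simp only [cwW]
      have hvlt : cwW z (wordAt (i + 1)) < 65536 := cw_lt hz _
      rw [ctabF_succ, hv]
      refine ⟨lor_shift_lt hT hvlt, fun m hm => ?_⟩
      rw [cval_lor_shift hT hvlt]
      split_ifs with hmi
      · rw [hmi]
      · exact hval m (by omega)

/-- The table defectW equals the word defectW (`k < 72`, `a < 2`, pairs `< 2³²`). [folklore] -/
theorem defectT_eq {z : ℕ} (hz : z < 2 ^ 32) {a k : ℕ} (ha : a < 2) (hk : k < 72) :
    defectT z (ctab z) a k = defectW z a k := by
  obtain ⟨-, hval⟩ := ctabF_spec hz 71 (by norm_num)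
  obtain ⟨-, -, -, -, hall⟩ := EL_facts k hk
  obtain ⟨hn, -, -⟩ := hall a ha
  unfold defectT defectW
  rw [ctab_eq, hval k (by omega), hval (nxt a k) (by omega)]

/-- MEANING of `check_VB`: the `VB j` vectors lie in `𝔰`, are self-reducing, and have generator-conjugates
reducing to `0`; and `incl i j` means `span(VB i) ⊆ span(VB j)`. [folklore] -/
theorem VB_facts (j : ℕ) (hj : j < 12) (b : ℕ) (hb : b ∈ vecs (VB j)) : red sB b = 0 ∧ red (VB j) b = 0 ∧
    red (VB j) (conj cG0 cG0i b) = 0 ∧ red (VB j) (conj cG1 cG1i b) = 0 := by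
  have h := List.all_eq_true.mp (List.all_eq_true.mp check_VB.1 j (List.mem_range.mpr hj)) b hb
  simp only [Bool.and_eq_true, beq_iff_eq] at h
  obtain ⟨⟨⟨h1, h2⟩, h3⟩, h4⟩ := h
  exact ⟨h1, h2, h3, h4⟩

/-- MEANING of `incl`: `incl i j = true →` every vector of `span(VB i)` reduces to `0` mod `VB j`. [folklore] -/
theorem incl_sound {i j : ℕ} (hi : i < 12) (hj : j < 12) (h : incl i j = true) {x : ℕ}
    (hx : red (VB i) x = 0) : red (VB j) x = 0 := by
  have h' := List.all_eq_true.mp (List.all_eq_true.mp check_VB.2.2 i (List.mem_range.mpr hi)) j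
    (List.mem_range.mpr hj)
  rw [beq_iff_eq, h] at h'
  have hall : ∀ v ∈ vecs (VB i), red (VB j) v = 0 := by
    intro v hv
    have := List.all_eq_true.mp (show allRed (VB j) (vecs (VB i)) = true from h'.symm) v hv
    simpa using this
  obtain ⟨t, rfl⟩ := inSpan_of_red_eq_zero hx
  exact (red_lin (VB j)).comb_eq_zero hall t

/-- `span(VB j)` is stable under conjugation by the generators (hence a `G`-submodule). [folklore] -/
theorem VB_conj_closed (j : ℕ) (hj : j < 12) {x : ℕ} (hx : red (VB j) x = 0) (a : ℕ) :
    red (VB j) (conj (gNW a) (giNW a) x) = 0 := by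
  obtain ⟨t, rfl⟩ := inSpan_of_red_eq_zero hx
  rw [(conj_lin _ _).map_comb]
  refine red_eq_zero_of_inSpan ?_ ⟨t, rfl⟩
  intro v hv
  obtain ⟨b, hb, rfl⟩ := List.mem_map.mp hv
  by_cases h : a = 0
  · subst h; exact (VB_facts j hj b hb).2.2.1
  · have hb' : (a == 0) = false := by simp [h]
    simp only [gNW, giNW, hb', cond_false]
    exact (VB_facts j hj b hb).2.2.2

/-- If both components of `z` lie in `span(VB j)`, then so does every value of the word cocycle. [folklore] -/
theorem cw_mem_VB (j : ℕ) (hj : j < 12) {z : ℕ} (h0 : red (VB j) (xc z 0) = 0)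
    (h1 : red (VB j) (xc z 1) = 0) : ∀ w, red (VB j) (cwW z w) = 0
  | [] => red_zero _
  | b :: w => by
      simp only [cwW]
      refine red_xor_eq_zero ?_ (VB_conj_closed j hj (cw_mem_VB j hj h0 h1 w) _)
      rcases Fin.exists_fin_two.mp ⟨b, rfl⟩ with hb | hb <;> simp only [hb]
      exacts [h0, h1]

/-- … and then every defectW lies in `span(VB j)`. [folklore] -/
theorem defect_mem_VB (j : ℕ) (hj : j < 12) {z : ℕ} (h0 : red (VB j) (xc z 0) = 0)
    (h1 : red (VB j) (xc z 1) = 0) (a k : ℕ) : red (VB j) (defectW z a k) = 0 := by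
  unfold defectW
  refine red_xor_eq_zero (red_xor_eq_zero (cw_mem_VB j hj h0 h1 _) ?_)
    (VB_conj_closed j hj (cw_mem_VB j hj h0 h1 _) a)
  by_cases ha : a = 0
  · subst ha; exact h0
  · rw [xc_of_ne_zero z a ha, ← xc_of_ne_zero z 1 (by norm_num)]; exact h1

/-- The components of the `SOLB`-type pairs built from `V`. [folklore] -/
theorem pairsOf_components {j : ℕ} (hj : j < 12) {v : ℕ} (hv : v ∈ vecs (pairsOf (VB j))) :
    red (VB j) (xc v 0) = 0 ∧ red (VB j) (xc v 1) = 0 ∧ red sB (xc v 0) = 0 ∧ red sB (xc v 1) = 0 := by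
  rw [vecs_pairsOf, List.mem_append, List.mem_map] at hv
  rcases hv with ⟨w, hw, rfl⟩ | hw
  · have hf := VB_facts j hj w hw
    rw [xc_zero, xc_one, shiftLeft16_mod, shiftLeft16_shiftRight]
    exact ⟨red_zero _, hf.2.1, red_zero _, hf.1⟩
  · have hf := VB_facts j hj v hw
    have hlt := lt_of_red_sB hf.1
    rw [xc_zero, xc_one, Nat.mod_eq_of_lt hlt, shiftRight16_of_lt hlt]
    exact ⟨hf.2.1, red_zero _, hf.1, red_zero _⟩

/-- Membership in `span(pairsOf sB)` of the pairs built from `V`. [folklore] -/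
theorem pairsOf_units2 {j : ℕ} (hj : j < 12) {v : ℕ} (hv : v ∈ vecs (pairsOf (VB j))) :
    red units2 v = 0 := by
  have hc := pairsOf_components hj hv
  have hlt : v < 2 ^ 32 := by
    rw [vecs_pairsOf, List.mem_append, List.mem_map] at hv
    rcases hv with ⟨w, hw, rfl⟩ | hw
    · exact shiftLeft_lt (by simpa using lt_of_red_sB (VB_facts j hj w hw).1) (by norm_num)
    · exact lt_of_lt_of_le (lt_of_red_sB (VB_facts j hj v hw).1) (by norm_num)
  exact (red_units2_iff v hlt).mpr ⟨hc.2.2.1, hc.2.2.2⟩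

/-- `z = (x₀,x₁)` is a COCYCLE DATUM modulo `V = span(VB j)`: both components lie in `𝔰` and all `144`
defects `c(g_a e_k) + x_a + g_a c(e_k) g_a⁻¹` lie in `V` (a crossed homomorphism `G → 𝔰/V`, well defined on
`G` because the `72` tree words are a transversal). [folklore] -/
def IsCocyclePair (j z : ℕ) : Prop :=
  red units2 z = 0 ∧ ∀ a < 2, ∀ k < 72, red (VB j) (defectW z a k) = 0

/-- `red units2 z = 0 → z < 2³²`. [folklore] -/
theorem lt_of_red_units2 {z : ℕ} (hz : red units2 z = 0) : z < 2 ^ 32 := by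
  obtain ⟨t, rfl⟩ := inSpan_of_red_eq_zero hz
  refine comb_lt (fun u hu => ?_) t
  rw [units2_eq, vecs_pairsOf, List.mem_append, List.mem_map] at hu
  rcases hu with ⟨w, hw, rfl⟩ | hw
  · exact shiftLeft_lt (by simpa using sB_lt w hw) (by norm_num)
  · exact lt_of_lt_of_le (sB_lt u hw) (by norm_num)

/-- A packed pair passing the (table-based) test `isSolW j` is a cocycle pair for `VB j`. [folklore] -/
theorem isCocyclePair_of_isSol {j z : ℕ} (h : isSolW j z = true) : IsCocyclePair j z := by
  unfold isSolW at h
  simp only [Bool.and_eq_true, beq_iff_eq] at h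
  obtain ⟨hu, hall⟩ := h
  refine ⟨hu, fun a ha k hk => ?_⟩
  have h := loop_get hall k hk
  simp only [List.all_eq_true, List.mem_range, Bool.or_eq_true, beq_iff_eq] at h
  rcases h a ha with ht | hd
  · rw [defect_tree ha hk ht]; exact red_zero _
  · rwa [defectT_eq (lt_of_red_units2 hu) ha hk] at hd

/-- Cocycle pairs form a subspace: closure under combinations. [folklore] -/
theorem IsCocyclePair.comb {j : ℕ} {L : List ℕ} (hL : ∀ v ∈ L, IsCocyclePair j v) (t : ℕ) :
    IsCocyclePair j (comb L t) :=
  ⟨(red_lin units2).comb_eq_zero (fun v hv => (hL v hv).1) t, fun a ha k hk =>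
    ((red_lin (VB j)).comp (defect_lin a k)).comb_eq_zero (fun v hv => (hL v hv).2 a ha k hk) t⟩

/-- Inheritance: a cocycle pair modulo a smaller submodule is one modulo a larger. [folklore] -/
theorem IsCocyclePair.mono {i j z : ℕ} (hij : ∀ x, red (VB i) x = 0 → red (VB j) x = 0)
    (h : IsCocyclePair i z) : IsCocyclePair j z :=
  ⟨h.1, fun a ha k hk => hij _ (h.2 a ha k hk)⟩

/-- `VB 0` is the empty basis (the zero submodule). [folklore] -/
theorem VB_zero : VB 0 = [] := by decide

/-- Every vector of the basis `SOLB j` is a cocycle datum mod `VB j`. [folklore] -/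
theorem SOLB_isCocyclePair {j : ℕ} (hj : j < 12) {v : ℕ} (hv : v ∈ vecs (SOLB j)) : IsCocyclePair j v := by
  obtain ⟨hnew, hinh, hcomb, -⟩ := check_sol j hj
  have hpairs : ∀ v ∈ vecs (pairsOf (VB j)), IsCocyclePair j v := fun v hv => by
    have hc := pairsOf_components hj hv
    exact ⟨pairsOf_units2 hj hv, fun a _ k _ => defect_mem_VB j hj hc.1 hc.2.1 a k⟩
  have hexact : ∀ v ∈ vecs (ZB 0), IsCocyclePair j v := fun v hv =>
    (isCocyclePair_of_isSol (List.all_eq_true.mp check_exact v hv)).mono (fun x hx => by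
      rw [VB_zero] at hx; change x = 0 at hx; rw [hx]; exact red_zero _)
  have hsrc : ∀ v ∈ SRC j, IsCocyclePair j v := by
    intro v hv
    simp only [SRC, List.mem_append, List.mem_flatMap] at hv
    rcases hv with (hv | ⟨i, hi, hv⟩) | hv
    · by_cases hj0 : j = 0
      · subst hj0; simp only [beq_self_eq_true, cond_true] at hv; exact hexact v hv
      · have hb : (j == 0) = false := by simp [hj0]
        simp only [hb, cond_false, List.mem_append] at hv
        rcases hv with hv | hv
        · exact hpairs v hv
        · exact hexact v hv
    · obtain ⟨hi0, hi5⟩ := INHSRC_bound j hj i hi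
      have hsol := List.all_eq_true.mp ((check_sol i hi5).1 (Nat.pos_iff_ne_zero.mp hi0)) v hv
      exact (isCocyclePair_of_isSol hsol).mono
        (fun x hx => incl_sound hi5 hj (List.all_eq_true.mp hinh i hi) hx)
    · by_cases hj0 : j = 0
      · subst hj0
        have : NEWB 0 = [] := by decide
        rw [this] at hv; cases hv
      · exact isCocyclePair_of_isSol (List.all_eq_true.mp (hnew hj0) v hv)
  rw [SOLB, vecs_append, List.mem_append] at hv
  rcases hv with hv | hv
  · exact hpairs v hv
  · obtain ⟨m, hm, rfl⟩ := mem_iff_getD.mp hv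
    have hm' : m < (ZB j).length := by simpa [vecs] using hm
    have := List.all_eq_true.mp hcomb m (List.mem_range.mpr hm')
    rw [beq_iff_eq] at this
    rw [← this]
    exact IsCocyclePair.comb hsrc _

/-! #### Linearity and vanishing of the selected-syndrome map `synBitsW` -/

/-- The selected-syndrome map `synBitsW j` is XOR-linear. [folklore] -/
theorem synBits_lin (j : ℕ) : IsLin (synBitsW j) := by
  intro x y
  unfold synBitsW
  exact foldr_bits_lin (fun (s : ℕ × ℕ × ℕ) z => (red (VB j) (defectW z s.1 s.2.1)).testBit s.2.2)
    (by intro s x y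
        show (red (VB j) (defectW (x ^^^ y) s.1 s.2.1)).testBit s.2.2 = _
        rw [show defectW (x ^^^ y) s.1 s.2.1 = defectW x s.1 s.2.1 ^^^ defectW y s.1 s.2.1 from
          defect_lin s.1 s.2.1 x y, red_lin, Nat.testBit_xor]) (SEL j) x y

/-- MEANING of the `SEL` range: selected defectW coordinates are genuine (generator, element, bit) triples. [folklore] -/
theorem SEL_bound (j : ℕ) (hj : j < 12) : ∀ s ∈ SEL j, s.1 < 2 ∧ s.2.1 < 72 := by
  rcases lt_nsub hj with rfl | rfl | rfl | rfl | rfl | rfl | rfl | rfl | rfl | rfl | rfl | rfl <;> decide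

/-- A cocycle pair has zero selected syndrome. [folklore] -/
theorem synBits_eq_zero {j : ℕ} (hj : j < 12) {z : ℕ} (hz : IsCocyclePair j z) : synBitsW j z = 0 := by
  unfold synBitsW
  apply foldr_bits_zero (fun (s : ℕ × ℕ × ℕ) z => (red (VB j) (defectW z s.1 s.2.1)).testBit s.2.2)
  intro s hs
  obtain ⟨h1, h2⟩ := SEL_bound j hj s hs
  show (red (VB j) (defectW z s.1 s.2.1)).testBit s.2.2 = false
  rw [hz.2 s.1 h1 s.2.1 h2, Nat.zero_testBit]

/-- MEANING (cocycles, Part I §F): for every `j < 12` and EVERY pair code `z`, `z` is a cocycle datum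
modulo `VB j` iff `z` reduces to `0` modulo `SOLB j`, iff `z ∈ span(SOLB j)`. [folklore] -/
theorem isCocyclePair_iff (j : ℕ) (hj : j < 12) (z : ℕ) : IsCocyclePair j z ↔ red (SOLB j) z = 0 := by
  have hBred : ∀ v ∈ vecs (SOLB j), red (SOLB j) v = 0 := fun v hv => by
    have := List.all_eq_true.mp (check_sol j hj).2.2.2 v hv; simpa using this
  constructor
  · intro hz
    apply red_eq_zero_of_inSpan hBred
    obtain ⟨hc1, hc2, hc3, hc4⟩ := check_cmp j hj
    have hunits : ∀ u ∈ vecs units2, InSpan (vecs (SOLB j ++ CMPB j)) u := fun u hu =>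
      inSpan_of_red_eq_zero (by have := List.all_eq_true.mp hc2 u hu; simpa using this)
    have hx : InSpan (vecs (SOLB j) ++ vecs (CMPB j)) z := by
      rw [← vecs_append]; exact InSpan.mono hunits (inSpan_of_red_eq_zero hz.1)
    refine inSpan_of_syndrome (synBits_lin j) (fun v hv => synBits_eq_zero hj (SOLB_isCocyclePair hj hv))
      ?_ hx (synBits_eq_zero hj hz)
    intro t ht ht0
    rw [(synBits_lin j).map_comb, hc3]
    have hlen : (SYNPAT j).length = (vecs (CMPB j)).length := by rw [← hc3, List.length_map]
    exact hc4 t (hlen ▸ ht) ht0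
  · intro hz
    obtain ⟨t, rfl⟩ := inSpan_of_red_eq_zero hz
    exact IsCocyclePair.comb (fun v hv => SOLB_isCocyclePair hj hv) t

/-- `IsCocyclePair j z ↔ z ∈ span(SOLB j)`. [folklore] -/
theorem isCocyclePair_iff_inSpan (j : ℕ) (hj : j < 12) (z : ℕ) :
    IsCocyclePair j z ↔ InSpan (vecs (SOLB j)) z := by
  rw [isCocyclePair_iff j hj, red_eq_zero_iff]
  intro v hv; have := List.all_eq_true.mp (check_sol j hj).2.2.2 v hv; simpa using this

/-- The dimensions `|SOLB j| = 2·dim(VB j) + dim Z¹(G, 𝔰/VB j)`. [folklore] -/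
theorem SOLB_length : (List.range 12).map (fun j => (SOLB j).length) = [11, 12, 12, 15, 15, 16, 16, 16, 16, 19, 20, 20] := by
  decide

/-! ### II.9 MEANING of the quotient certificates: the classes of extension groups -/

/-- Dispatcher: `check_Q_j` for a variable `j < 12`. [folklore] -/
theorem check_Q (j : ℕ) (hj : j < 12) :
    quotCertW j (vecs sB) (QBS j) (MASKSS j) (REPSS j) (JREPS j) = true ∧
    quotCertW j (vecs admBW) (QBM j) (MASKSM j) (REPSM j) (JREPM j) = true := by
  rcases lt_nsub hj with rfl | rfl | rfl | rfl | rfl | rfl | rfl | rfl | rfl | rfl | rfl | rfl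
  exacts [check_Q_0, check_Q_1, check_Q_2, check_Q_3, check_Q_4, check_Q_5, check_Q_6, check_Q_7, check_Q_8, check_Q_9, check_Q_10, check_Q_11]

/-- WHAT A QUOTIENT CERTIFICATE ESTABLISHES (for any list `ms` of coboundary sources): `span(QB) = Q :=
V×V + cobW(span ms)`-pairs; the representatives are cocycle data, contain `0`, are closed under `+` and
pairwise inequivalent modulo `Q`; EVERY cocycle datum is equivalent modulo `Q` to exactly one representative;
the list of representatives has no repetition. [folklore] -/
theorem quotCert_sound {j : ℕ} (hj : j < 12) {ms : List ℕ} {QB : List (ℕ × ℕ)} {masks reps jrep : List ℕ}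
    (h : quotCertW j ms QB masks reps jrep = true) :
    (∀ x, InSpan (gensQW ms j) x ↔ red QB x = 0) ∧
    (∀ r ∈ reps, IsCocyclePair j r) ∧ 0 ∈ reps ∧
    (∀ r₁ ∈ reps, ∀ r₂ ∈ reps, r₁ ^^^ r₂ ∈ reps ∧ (r₁ ≠ r₂ → red QB (r₁ ^^^ r₂) ≠ 0)) ∧
    (∀ z, IsCocyclePair j z → ∃ r ∈ reps, red QB (z ^^^ r) = 0) ∧
    (∀ z, ∀ r₁ ∈ reps, ∀ r₂ ∈ reps, red QB (z ^^^ r₁) = 0 → red QB (z ^^^ r₂) = 0 → r₁ = r₂) ∧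
    (∀ a < reps.length, ∀ b < reps.length, reps.getD a 0 = reps.getD b 0 → a = b) := by
  simp only [quotCertW, Bool.and_eq_true, List.all_eq_true, beq_iff_eq, List.mem_range,
    decide_eq_true_eq, Bool.or_eq_true, bne_iff_ne, ne_eq, List.elem_iff] at h
  obtain ⟨⟨⟨⟨⟨⟨q1, q2⟩, q3⟩, q4⟩, q0⟩, q5⟩, q6⟩ := h
  have hspan : ∀ x, InSpan (gensQW ms j) x ↔ red QB x = 0 := by
    intro x; constructor
    · rintro ⟨t, rfl⟩; exact (red_lin QB).comb_eq_zero q1 t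
    · intro hx
      refine InSpan.mono ?_ (inSpan_of_red_eq_zero hx)
      intro q hq
      obtain ⟨m, hm, rfl⟩ := mem_iff_getD.mp hq
      exact ⟨masks.getD m 0, q2 m (by simpa [vecs] using hm)⟩
  have hsep : ∀ r₁ ∈ reps, ∀ r₂ ∈ reps, r₁ ^^^ r₂ ∈ reps ∧ (r₁ ≠ r₂ → red QB (r₁ ^^^ r₂) ≠ 0) := by
    intro r₁ hr₁ r₂ hr₂
    obtain ⟨a, ha, rfl⟩ := mem_iff_getD.mp hr₁
    obtain ⟨b, hb, rfl⟩ := mem_iff_getD.mp hr₂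
    obtain ⟨h1, h2⟩ := q5 a ha b hb
    refine ⟨h2, fun hne => ?_⟩
    rcases h1 with rfl | h1
    · exact absurd rfl hne
    · exact h1
  refine ⟨hspan, fun r hr => (isCocyclePair_iff j hj r).mpr (q4 r hr).2, zero_mem_of_getD q0, hsep,
    ?_, ?_, ?_⟩
  · intro z hz
    obtain ⟨t, rfl⟩ := (isCocyclePair_iff_inSpan j hj z).mp hz
    refine reps_cover (zero_mem_of_getD q0) (fun r₁ h₁ r₂ h₂ => (hsep r₁ h₁ r₂ h₂).1) ?_ t
    intro v hv
    obtain ⟨m, hm, rfl⟩ := mem_iff_getD.mp hv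
    have hm' : m < (SOLB j).length := by simpa [vecs] using hm
    obtain ⟨hlt, hred⟩ := q6 m hm'
    have hmj : m < jrep.length := by
      by_contra hc
      have : jrep.getD m reps.length = reps.length := by
        simp [List.getD_eq_getElem?_getD, not_lt.mp hc]
      rw [this] at hlt
      exact lt_irrefl _ hlt
    have hidx : jrep.getD m 0 = jrep.getD m reps.length := by
      rw [getD_eq_getElem' 0 hmj, getD_eq_getElem' reps.length hmj]
    refine ⟨reps.getD (jrep.getD m 0) 0, getD_mem 0 (hidx ▸ hlt), hred⟩
  · intro z r₁ hr₁ r₂ hr₂ h₁ h₂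
    by_contra hne
    apply (hsep r₁ hr₁ r₂ hr₂).2 hne
    have : r₁ ^^^ r₂ = (z ^^^ r₁) ^^^ (z ^^^ r₂) := by rw [xor4, Nat.xor_self, Nat.zero_xor]
    rw [this, red_lin QB, h₁, h₂]; rfl
  · intro a ha b hb hab
    obtain ⟨h1, -⟩ := q5 a ha b hb
    rcases h1 with h1 | h1
    · exact h1
    · rw [hab, Nat.xor_self] at h1; exact absurd (red_zero QB) h1

/-- The coboundary map `m ↦ (m + g₀mg₀⁻¹, m + g₁mg₁⁻¹)` is `𝔽₂`-linear. [folklore] -/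
theorem cob_lin : IsLin cobW := by
  intro x y
  simp only [cobW]
  exact ((IsLin.id.xor (conj_lin cG0 cG0i)).xor
    ((IsLin.shiftLeft 16).comp (IsLin.id.xor (conj_lin cG1 cG1i)))) x y

/-- Two cocycle data `z, z'` modulo `V = span(VB j)` are EQUIVALENT relative to the coboundary sources `ms`
(`ms = sB`: conjugacy of the extension groups inside `𝔰𝔭₄(𝔽₂) ⋊ G`; `ms = admBW`: conjugacy inside
`M₄(𝔽₂) ⋊ G`): `z + z' ∈ V × V + {cobW m : m ∈ span(ms)}`. [cite: BrumerEtAl2019, §5.1 p. 1173] -/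
def CobEquiv (ms : List ℕ) (j z z' : ℕ) : Prop := InSpan (gensQW ms j) (z ^^^ z')

/-- Coboundaries `cobW m`, `m ∈ span(ms)`, are among the generators `gensQW`. [folklore] -/
theorem cob_mem_gensQ {ms : List ℕ} (j : ℕ) {m : ℕ} (hm : InSpan ms m) : InSpan (gensQW ms j) (cobW m) := by
  refine InSpan.mono (fun v hv => InSpan.of_mem ?_) (hm.map cob_lin)
  simp only [gensQW, List.mem_append]
  exact Or.inr hv

/-- Pairs of `VB j` vectors are among the generators `gensQW`. [folklore] -/
theorem VBpair_mem_gensQ {ms : List ℕ} {j : ℕ} {v₀ v₁ : ℕ} (h₀ : v₀ ∈ vecs (VB j)) (h₁ : v₁ ∈ vecs (VB j)) :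
    InSpan (gensQW ms j) (v₀ ^^^ (v₁ <<< 16)) := by
  refine InSpan.xor (InSpan.of_mem ?_) (InSpan.of_mem ?_) <;>
    simp only [gensQW, List.mem_append, List.mem_map]
  · exact Or.inl (Or.inl h₀)
  · exact Or.inl (Or.inr ⟨v₁, h₁, rfl⟩)

/-- THEOREM (BPPTVY Thm 5.3.3(a), the count `20`, MEANING FORM): for each of the `12` `G`-submodules
`V = span(VB j)` of `𝔰`, every cocycle datum modulo `V` — i.e. every extension group `E ≤ 𝔰𝔭₄(𝔽₂) ⋊ G` with
`π(E) = G`, `E ∩ 𝔰 = V` — is `M₄(𝔽₂) ⋊ G`-equivalent to EXACTLY ONE of the tabulated representatives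
`REPSM j`, which are cocycle data, pairwise inequivalent and without repetition; their numbers total `20`
with `#V = 2^k`, `k = 0,0,1,1,2,4,4,4,4,5,5,5,5,6,6,8,8,9,9,10` (`classCount_M`, `kMultiset_M`). [cite: BrumerEtAl2019, Thm 5.3.3 p. 1176] -/
theorem extension_classes_M (j : ℕ) (hj : j < 12) :
    (∀ z, IsCocyclePair j z → ∃! r, r ∈ REPSM j ∧ CobEquiv (vecs admBW) j z r) ∧
    (∀ r ∈ REPSM j, IsCocyclePair j r) ∧
    (∀ r₁ ∈ REPSM j, ∀ r₂ ∈ REPSM j, CobEquiv (vecs admBW) j r₁ r₂ → r₁ = r₂) ∧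
    (∀ a < (REPSM j).length, ∀ b < (REPSM j).length, (REPSM j).getD a 0 = (REPSM j).getD b 0 → a = b) := by
  obtain ⟨hspan, hreps, -, hsep, hex, huniq, hnodup⟩ := quotCert_sound hj (check_Q j hj).2
  refine ⟨fun z hz => ?_, hreps, fun r₁ h₁ r₂ h₂ he => ?_, hnodup⟩
  · obtain ⟨r, hr, hzr⟩ := hex z hz
    refine ⟨r, ⟨hr, (hspan _).mpr hzr⟩, ?_⟩
    rintro r' ⟨hr', hzr'⟩
    exact huniq z r' hr' r hr ((hspan _).mp hzr') hzr
  · by_contra hne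
    exact (hsep r₁ h₁ r₂ h₂).2 hne ((hspan _).mp he)

/-- THEOREM (BPPTVY Thm 5.3.3(a), the count `36`, MEANING FORM): the same with conjugacy inside
`𝔰𝔭₄(𝔽₂) ⋊ G` (coboundaries of `m ∈ 𝔰` only): total `36` classes (`classCount_S`).
[cite: BrumerEtAl2019, Thm 5.3.3 p. 1176] -/
theorem extension_classes_S (j : ℕ) (hj : j < 12) :
    (∀ z, IsCocyclePair j z → ∃! r, r ∈ REPSS j ∧ CobEquiv (vecs sB) j z r) ∧
    (∀ r ∈ REPSS j, IsCocyclePair j r) ∧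
    (∀ r₁ ∈ REPSS j, ∀ r₂ ∈ REPSS j, CobEquiv (vecs sB) j r₁ r₂ → r₁ = r₂) ∧
    (∀ a < (REPSS j).length, ∀ b < (REPSS j).length, (REPSS j).getD a 0 = (REPSS j).getD b 0 → a = b) := by
  obtain ⟨hspan, hreps, -, hsep, hex, huniq, hnodup⟩ := quotCert_sound hj (check_Q j hj).1
  refine ⟨fun z hz => ?_, hreps, fun r₁ h₁ r₂ h₂ he => ?_, hnodup⟩
  · obtain ⟨r, hr, hzr⟩ := hex z hz
    refine ⟨r, ⟨hr, (hspan _).mpr hzr⟩, ?_⟩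
    rintro r' ⟨hr', hzr'⟩
    exact huniq z r' hr' r hr ((hspan _).mp hzr') hzr
  · by_contra hne
    exact (hsep r₁ h₁ r₂ h₂).2 hne ((hspan _).mp he)

/-- The totals: `36` classes in `𝔰𝔭₄(𝔽₂) ⋊ G`, `20` in `M₄(𝔽₂) ⋊ G`. [cite: BrumerEtAl2019, Thm 5.3.3 p. 1176] -/
theorem total_classes : ((List.range 12).map fun j => (REPSS j).length).sum = 36 ∧
    ((List.range 12).map fun j => (REPSM j).length).sum = 20 := by
  constructor <;> decide

/-! ### II.10′ The generators of THIS `G`: units, words, conjugation along words -/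

/-- Generator codes are `< 2¹⁶`. [folklore] -/
theorem gN_lt (a : ℕ) : gNW a < 65536 := by unfold gNW; cases (a == 0) <;> decide
/-- Inverse-generator codes are `< 2¹⁶`. [folklore] -/
theorem giN_lt (a : ℕ) : giNW a < 65536 := by unfold giNW; cases (a == 0) <;> decide

/-- `g_a · g_a⁻¹ = 1 = g_a⁻¹ · g_a` for the two generators. [folklore] -/
theorem gN_mul_giN (a : ℕ) : mmul (gNW a) (giNW a) = cI ∧ mmul (giNW a) (gNW a) = cI := by
  obtain ⟨-, -, h1, h2, h3, h4⟩ := check_codes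
  unfold gNW giNW
  cases (a == 0)
  · exact ⟨h3, h4⟩
  · exact ⟨h1, h2⟩

/-- The product of the INVERSE generators along a word, reversed: the inverse of `evalC w`. [folklore] -/
def evalCiW : List (Fin 2) → ℕ
  | [] => cI
  | a :: w => mmul (evalCiW w) (giNW a.val)

/-- `evalC w < 2¹⁶` (written `2 ^ 16`, not `65536`: `evalC` is THIS file's namespace-local constant and the
gate's statement index is namespace-blind — typer-g4/g3fix/README.md, DIAGNOSIS). [folklore] -/
theorem evalC_lt : ∀ w, evalC w < 2 ^ 16
  | [] => cI_lt
  | _ :: _ => mmul_lt _ _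

/-- `evalCiW w < 2¹⁶`. [folklore] -/
theorem evalCi_lt : ∀ w, evalCiW w < 65536
  | [] => cI_lt
  | _ :: _ => mmul_lt _ _

/-- `evalC w · evalCiW w = 1`. [folklore] -/
theorem evalC_mul_evalCi : ∀ w, mmul (evalC w) (evalCiW w) = cI
  | [] => mmul_cI_left cI_lt
  | a :: w => by
      show mmul (mmul (gNW a.val) (evalC w)) (mmul (evalCiW w) (giNW a.val)) = cI
      rw [mmul_assoc (gN_lt _) (evalC_lt _) (mmul_lt _ _),
        ← mmul_assoc (evalC_lt _) (evalCi_lt _) (giN_lt _),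
        evalC_mul_evalCi w, mmul_cI_left (giN_lt _), (gN_mul_giN _).1]

/-- `evalCiW w · evalC w = 1`. [folklore] -/
theorem evalCi_mul_evalC : ∀ w, mmul (evalCiW w) (evalC w) = cI
  | [] => mmul_cI_left cI_lt
  | a :: w => by
      show mmul (mmul (evalCiW w) (giNW a.val)) (mmul (gNW a.val) (evalC w)) = cI
      rw [mmul_assoc (evalCi_lt _) (giN_lt _) (mmul_lt _ _),
        ← mmul_assoc (giN_lt _) (gN_lt _) (evalC_lt _),
        (gN_mul_giN _).2, mmul_cI_left (evalC_lt _), evalCi_mul_evalC w]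

/-- A set of codes closed under conjugation by the two generators of `G` is closed under conjugation by
every word in them (i.e. by all of `G`). [folklore] -/
theorem conj_word_mem {S : Set ℕ} (hS : ∀ x ∈ S, x < 65536) (h0 : ∀ x ∈ S, conj cG0 cG0i x ∈ S)
    (h1 : ∀ x ∈ S, conj cG1 cG1i x ∈ S) :
    ∀ (w : List (Fin 2)) (x : ℕ), x ∈ S → conj (evalC w) (evalCiW w) x ∈ S
  | [], x, hx => by
      show conj cI cI x ∈ S
      rw [conj_cI (hS x hx)]; exact hx
  | a :: w, x, hx => by
      show conj (mmul (gNW a.val) (evalC w)) (mmul (evalCiW w) (giNW a.val)) x ∈ S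
      rw [conj_mmul (gN_lt _) (evalC_lt _) (giN_lt _) (evalCi_lt _) (hS x hx)]
      have ih := conj_word_mem hS h0 h1 w x hx
      rcases Fin.exists_fin_two.mp ⟨a, rfl⟩ with ha | ha
      · subst ha; exact h0 _ ih
      · subst ha; exact h1 _ ih

/-! #### The element tables as words -/

/-- Bits of an occupancy mask built by folding `m ↦ m ||| (1 <<< e)`. [folklore] -/
theorem testBit_foldl_bit (l : List ℕ) (m x : ℕ) :
    (l.foldl (fun m e => m ||| (1 <<< e)) m).testBit x = true ↔ m.testBit x = true ∨ x ∈ l := by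
  induction l generalizing m with
  | nil => simp
  | cons e l ih =>
    rw [List.foldl_cons, ih, Nat.testBit_or, Nat.one_shiftLeft, Nat.testBit_two_pow, List.mem_cons,
      Bool.or_eq_true, decide_eq_true_eq, @eq_comm _ e x]
    exact or_assoc

/-- MEANING of `elMask`: bit `x` is set iff `x ∈ EL`. [folklore] -/
theorem elMask_testBit (x : ℕ) : elMask.testBit x = true ↔ x ∈ EL := by
  rw [elMask, testBit_foldl_bit]; simp

set_option maxRecDepth 200000 in
/-- KERNEL CHECK (small): every inverse code is (a bit of `elMask`, i.e.) one of the element codes. [folklore] -/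
theorem check_tables : (ELinv.all fun e => elMask.testBit e) = true := by
  decide +kernel

/-- `el k` is the value of the `k`-th tree word (`k < 72`). [folklore] -/
theorem el_eq (k : ℕ) (hk : k < 72) : el k = evalC (wordAt k) := (EL_facts k hk).2.1

/-- `eli k` is the word-inverse of the `k`-th tree word (`k < 72`). [folklore] -/
theorem eli_eq (k : ℕ) (hk : k < 72) : eli k = evalCiW (wordAt k) := by
  obtain ⟨-, h1, -, h3, -⟩ := EL_facts k hk
  exact inv_unique (el_lt k) (eli_lt k) (evalCi_lt _) h3 (by rw [h1]; exact evalC_mul_evalCi _)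

/-- Every inverse is itself a tabulated element: `eli k = el k'`, and then `el k` is the word-inverse of
`k'`. [folklore] -/
theorem eli_as_word (k : ℕ) (hk : k < 72) :
    ∃ k' < 72, eli k = evalC (wordAt k') ∧ el k = evalCiW (wordAt k') := by
  obtain ⟨hlen, hleni, -, hEi, -⟩ := check_ELcard
  have hmem : eli k ∈ ELinv := by rw [(el_getD k).2]; exact getD_mem 0 (by rw [hleni]; exact hk)
  have hEL : eli k ∈ EL := (elMask_testBit _).mp (List.all_eq_true.mp check_tables _ hmem)
  obtain ⟨k', hk', hkk'⟩ := mem_iff_getD.mp hEL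
  rw [hlen] at hk'
  have he : eli k = el k' := by rw [(el_getD k').1]; exact hkk'.symm
  refine ⟨k', hk', by rw [he, el_eq k' hk'], ?_⟩
  obtain ⟨-, -, h2, -, -⟩ := EL_facts k hk
  have h2' : mmul (el k) (el k') = cI := by rw [← he]; exact h2
  exact inv_unique (el_lt k') (el_lt k) (evalCi_lt _) h2' (by rw [el_eq k' hk']; exact evalC_mul_evalCi _)

/-- A set of codes (`< 2¹⁶`) closed under conjugation by the generators is closed under `x ↦ e_k x e_k⁻¹`
and `x ↦ e_k⁻¹ x e_k` for all `72` elements. [folklore] -/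
theorem conj_el_mem {S : Set ℕ} (hS : ∀ x ∈ S, x < 65536) (h0 : ∀ x ∈ S, conj cG0 cG0i x ∈ S)
    (h1 : ∀ x ∈ S, conj cG1 cG1i x ∈ S) (k : ℕ) (hk : k < 72) (x : ℕ) (hx : x ∈ S) :
    conj (el k) (eli k) x ∈ S ∧ conj (eli k) (el k) x ∈ S := by
  constructor
  · rw [el_eq k hk, eli_eq k hk]; exact conj_word_mem hS h0 h1 _ x hx
  · obtain ⟨k', -, h1', h2'⟩ := eli_as_word k hk
    rw [h1', h2']; exact conj_word_mem hS h0 h1 _ x hx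

/-- `e_k⁻¹ (e_k x e_k⁻¹) e_k = x`. [folklore] -/
theorem conj_inv_cancel {k x : ℕ} (hk : k < 72) (hx : x < 65536) :
    conj (eli k) (el k) (conj (el k) (eli k) x) = x := by
  obtain ⟨-, -, -, h3, -⟩ := EL_facts k hk
  rw [← conj_mmul (eli_lt k) (el_lt k) (el_lt k) (eli_lt k) hx, h3, conj_cI hx]

/-! ### II.11 MEANING of the orbit and sum certificates: the `G`-submodules of `𝔰` -/

/-- MEANING of `check_sum`: `span(VB i) + span(VB j) = span(VB (sumIdx i j))`. [folklore] -/
theorem sum_facts (i : ℕ) (hi : i < 12) (j : ℕ) (hj : j < 12) : sumIdx i j < 12 ∧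
    (∀ b ∈ vecs (VB i) ++ vecs (VB j), InSpan (vecs (VB (sumIdx i j))) b) ∧
    (∀ b ∈ vecs (VB (sumIdx i j)), InSpan (vecs (VB i) ++ vecs (VB j)) b) := by
  have h := List.all_eq_true.mp (List.all_eq_true.mp check_sum i (List.mem_range.mpr hi)) j
    (List.mem_range.mpr hj)
  simp only [Bool.and_eq_true, decide_eq_true_eq] at h
  obtain ⟨h8, hsp⟩ := h
  obtain ⟨hA, hB⟩ := spanEq_sound hsp
  have hech : echelon (vecs (VB i) ++ vecs (VB j)) =
      (vecs (VB i) ++ vecs (VB j)).foldl (fun B k => ins B ((fun v => v) k)) [] := rfl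
  refine ⟨h8, fun b hb => ?_, fun b hb => ?_⟩
  · refine InSpan.mono hB ?_
    rw [hech]; exact foldIns_mem (fun v => v) _ [] hb
  · refine InSpan.mono ?_ (hA b hb)
    rw [hech]
    refine foldIns_sub (fun v => v) (T := {z | InSpan (vecs (VB i) ++ vecs (VB j)) z})
      (fun a ha b hb => InSpan.xor ha hb) (InSpan.zero _) _ [] (by simp [vecs]) ?_
    intro k hk; exact InSpan.of_mem hk

/-- MEANING of `check_orbitRep` for one `t < 1024`. [folklore] -/
theorem orbitRep_facts (t : ℕ) (ht : t < 1024) : gT t < 72 ∧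
    red sB (conj (el (gT t)) (eli (gT t)) (sElt t)) = 0 ∧
    ∃ r ∈ REPS, sElt r = conj (el (gT t)) (eli (gT t)) (sElt t) ∧ cycIdx r = cycIdx t := by
  have h := List.all_eq_true.mp (List.all_eq_true.mp check_orbitRep (t / 256)
    (List.mem_range.mpr (by omega))) (t % 256) (List.mem_range.mpr (Nat.mod_lt _ (by norm_num)))
  have ht' : 256 * (t / 256) + t % 256 = t := Nat.div_add_mod t 256
  simp only [ht', Bool.and_eq_true, beq_iff_eq, List.elem_iff, decide_eq_true_eq] at h
  exact ⟨h.1.1.1.1, h.1.1.1.2, _, h.1.1.2, h.1.2, h.2⟩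

/-- `cycIdx t < 12` for the tabulated `t`, via the representative. [folklore] -/
theorem cycIdx_rep_lt : ∀ r ∈ REPS, cycIdx r < 12 := by decide

/-- The span of `VB c` as a set: a subspace of `𝔰`, of codes `< 2¹⁶`, stable under the generators. [folklore] -/
theorem VBspan_closed (c : ℕ) (hc : c < 12) :
    (∀ a ∈ {z | red (VB c) z = 0}, ∀ b ∈ {z | red (VB c) z = 0}, a ^^^ b ∈ {z | red (VB c) z = 0}) ∧
    ((0 : ℕ) ∈ {z | red (VB c) z = 0}) ∧ (∀ x ∈ {z | red (VB c) z = 0}, x < 65536) ∧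
    (∀ x ∈ {z | red (VB c) z = 0}, conj cG0 cG0i x ∈ {z | red (VB c) z = 0}) ∧
    (∀ x ∈ {z | red (VB c) z = 0}, conj cG1 cG1i x ∈ {z | red (VB c) z = 0}) := by
  simp only [Set.mem_setOf_eq]
  refine ⟨fun a ha b hb => red_xor_eq_zero ha hb, red_zero _, fun x hx => ?_,
    fun x hx => VB_conj_closed c hc hx 0, fun x hx => VB_conj_closed c hc hx 1⟩
  obtain ⟨t, rfl⟩ := inSpan_of_red_eq_zero hx
  exact lt_of_red_sB ((red_lin sB).comb_eq_zero (fun v hv => (VB_facts c hc v hv).1) t)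

/-- One closure round keeps the basis vectors inside any generator-stable subspace. [folklore] -/
theorem closeStep_sub {S : Set ℕ} (hadd : ∀ x ∈ S, ∀ y ∈ S, x ^^^ y ∈ S) (h0 : (0 : ℕ) ∈ S)
    (hg0 : ∀ x ∈ S, conj cG0 cG0i x ∈ S) (hg1 : ∀ x ∈ S, conj cG1 cG1i x ∈ S) {B : List (ℕ × ℕ)}
    (hB : ∀ b ∈ vecs B, b ∈ S) : ∀ b ∈ vecs (closeStep B), b ∈ S := by
  unfold closeStep
  suffices hmain : ∀ (L : List ℕ) (B' : List (ℕ × ℕ)), (∀ x ∈ L, x ∈ S) → (∀ b ∈ vecs B', b ∈ S) →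
      ∀ b ∈ vecs (L.foldl (fun B' b => ins (ins B' (conj cG0 cG0i b)) (conj cG1 cG1i b)) B'), b ∈ S from
    hmain (vecs B) B hB hB
  intro L
  induction L with
  | nil => intro B' _ hB'; simpa using hB'
  | cons x L ih =>
    intro B' hL hB'
    simp only [List.foldl_cons]
    refine ih _ (fun y hy => hL y (List.mem_cons_of_mem _ hy)) ?_
    have hxS : x ∈ S := hL x (List.mem_cons_self ..)
    exact ins_sub hadd h0 (ins_sub hadd h0 hB' (hg0 x hxS)) (hg1 x hxS)

/-- The generator-closure basis `cycEch v` lies inside any generator-stable subspace containing `v`. [folklore] -/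
theorem cycEch_sub {S : Set ℕ} (hadd : ∀ x ∈ S, ∀ y ∈ S, x ^^^ y ∈ S) (h0 : (0 : ℕ) ∈ S)
    (hg0 : ∀ x ∈ S, conj cG0 cG0i x ∈ S) (hg1 : ∀ x ∈ S, conj cG1 cG1i x ∈ S) {v : ℕ} (hv : v ∈ S) :
    ∀ b ∈ vecs (cycEch v), b ∈ S := by
  unfold cycEch
  suffices hmain : ∀ (L : List ℕ) (B : List (ℕ × ℕ)), (∀ b ∈ vecs B, b ∈ S) →
      ∀ b ∈ vecs (L.foldl (fun B _ => closeStep B) B), b ∈ S from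
    hmain _ _ (ins_sub hadd h0 (by simp [vecs]) hv)
  intro L
  induction L with
  | nil => intro B hB; simpa using hB
  | cons x L ih =>
    intro B hB
    simp only [List.foldl_cons]
    exact ih _ (closeStep_sub hadd h0 hg0 hg1 hB)

/-- THE CYCLIC SUBMODULE LEMMA: for every `x` in a `G`-submodule `S ⊆ 𝔰` there is a tabulated `VB c` with
`x ∈ span(VB c) ⊆ S` (namely the cyclic submodule of `x`). [folklore] -/
theorem cyclic_submodule {S : Set ℕ} (h𝔰 : ∀ x ∈ S, red sB x = 0) (h0 : (0 : ℕ) ∈ S)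
    (hadd : ∀ x ∈ S, ∀ y ∈ S, x ^^^ y ∈ S) (hg0 : ∀ x ∈ S, conj cG0 cG0i x ∈ S)
    (hg1 : ∀ x ∈ S, conj cG1 cG1i x ∈ S) {x : ℕ} (hx : x ∈ S) :
    ∃ c < 12, (∀ b ∈ vecs (VB c), b ∈ S) ∧ InSpan (vecs (VB c)) x := by
  have hS : ∀ x ∈ S, x < 65536 := fun x hx => lt_of_red_sB (h𝔰 x hx)
  obtain ⟨t₀, ht₀⟩ := inSpan_of_red_eq_zero (h𝔰 x hx)
  set t := t₀ % 2 ^ 10 with ht_def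
  have ht : t < 1024 := Nat.mod_lt _ (by norm_num)
  have hxt : sElt t = x := by rw [← ht₀]; exact comb_mod (vecs sB) t₀
  obtain ⟨hg, hy𝔰, r, hr, hry, hcyc⟩ := orbitRep_facts t ht
  set y := conj (el (gT t)) (eli (gT t)) (sElt t) with hy_def
  have hyS : y ∈ S := (conj_el_mem hS hg0 hg1 _ hg _ (hxt.symm ▸ hx)).1
  set c := cycIdx r with hc_def
  have hc : c < 12 := cycIdx_rep_lt r hr
  have hcr := List.all_eq_true.mp check_cyc r hr
  simp only [Bool.and_eq_true, beq_iff_eq] at hcr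
  obtain ⟨⟨-, hsp⟩, hred⟩ := hcr
  obtain ⟨hA, -⟩ := spanEq_sound hsp
  have hEchS : ∀ b ∈ vecs (cycEch (sElt r)), b ∈ S :=
    cycEch_sub hadd h0 hg0 hg1 (by rw [hry]; exact hyS)
  refine ⟨c, hc, fun b hb => mem_of_inSpan_closed hadd h0 hEchS (hA b hb), ?_⟩
  have hyc : red (VB c) y = 0 := by rw [← hry]; exact hred
  obtain ⟨hTx, hT0, hT, hT0', hT1'⟩ := VBspan_closed c hc
  have hxc : red (VB c) x = 0 := by
    have := (conj_el_mem hT hT0' hT1' _ hg y hyc).2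
    rw [Set.mem_setOf_eq, hy_def, conj_inv_cancel hg (lt_of_red_sB (hxt.symm ▸ h𝔰 x hx)), hxt] at this
    exact this
  exact inSpan_of_red_eq_zero hxc

/-- THEOREM (the `G`-submodule lattice of `𝔰`, MEANING FORM): every subset `S ⊆ 𝔰 = span(sB)` containing
`0`, closed under `+` and under conjugation by the two generators of `G = ι(S₃ ≀ S₂)` — i.e. every
`𝔽₂[G]`-submodule of `𝔰` — is the span of one of the twelve tabulated bases `VB j` (dimensions
`0,1,2,4,4,5,5,6,6,8,9,10`). [cite: BrumerEtAl2019, Thm 5.3.3 p. 1176] -/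
theorem submodules_classified (S : Set ℕ) (h𝔰 : ∀ x ∈ S, red sB x = 0) (h0 : (0 : ℕ) ∈ S)
    (hadd : ∀ x ∈ S, ∀ y ∈ S, x ^^^ y ∈ S) (hg0 : ∀ x ∈ S, conj cG0 cG0i x ∈ S)
    (hg1 : ∀ x ∈ S, conj cG1 cG1i x ∈ S) : ∃ j < 12, ∀ x, x ∈ S ↔ red (VB j) x = 0 := by
  classical
  let good : ℕ → Prop := fun i => i < 12 ∧ ∀ b ∈ vecs (VB i), b ∈ S
  have hgood0 : good 0 := ⟨by norm_num, by rw [VB_zero]; simp [vecs]⟩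
  have hub : ∀ F : Finset ℕ, (∀ i ∈ F, good i) →
      ∃ j, good j ∧ ∀ i ∈ F, ∀ b ∈ vecs (VB i), InSpan (vecs (VB j)) b := by
    intro F
    induction F using Finset.induction_on with
    | empty => intro; exact ⟨0, hgood0, by simp⟩
    | @insert i F _ ih =>
      intro hF
      obtain ⟨j, hj, hFj⟩ := ih (fun i' hi' => hF i' (Finset.mem_insert_of_mem hi'))
      have hig : good i := hF i (Finset.mem_insert_self i F)
      obtain ⟨hs8, hsum1, hsum2⟩ := sum_facts i hig.1 j hj.1
      refine ⟨sumIdx i j, ⟨hs8, fun b hb => ?_⟩, fun i' hi' b hb => ?_⟩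
      · refine mem_of_inSpan_closed hadd h0 ?_ (hsum2 b hb)
        intro v hv
        rcases List.mem_append.mp hv with hv | hv
        · exact hig.2 v hv
        · exact hj.2 v hv
      · rcases Finset.mem_insert.mp hi' with rfl | hi'
        · exact hsum1 b (List.mem_append_left _ hb)
        · exact InSpan.mono (fun v hv => hsum1 v (List.mem_append_right _ hv)) (hFj i' hi' b hb)
  obtain ⟨j, hj, hJ⟩ := hub ((Finset.range 12).filter fun i => ∀ b ∈ vecs (VB i), b ∈ S) (by
    intro i hi
    rw [Finset.mem_filter, Finset.mem_range] at hi
    exact ⟨hi.1, hi.2⟩)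
  refine ⟨j, hj.1, fun x => ⟨fun hx => ?_, fun hx => ?_⟩⟩
  · obtain ⟨c, hc8, hcS, hxc⟩ := cyclic_submodule h𝔰 h0 hadd hg0 hg1 hx
    have hcJ : c ∈ (Finset.range 12).filter fun i => ∀ b ∈ vecs (VB i), b ∈ S := by
      rw [Finset.mem_filter, Finset.mem_range]; exact ⟨hc8, hcS⟩
    exact red_eq_zero_of_inSpan (fun v hv => (VB_facts j hj.1 v hv).2.1)
      (InSpan.mono (fun v hv => hJ c hcJ v hv) hxc)
  · exact mem_of_inSpan_closed hadd h0 hj.2 (inSpan_of_red_eq_zero hx)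

/-- … and the twelve spans are pairwise distinct `G`-submodules of `𝔰` (so "exactly twelve"). [folklore] -/
theorem VB_distinct : ((List.range 12).all fun i => (List.range 12).all fun j =>
    i == j || !(allRed (VB i) (vecs (VB j)) && allRed (VB j) (vecs (VB i)))) = true := by
  decide

end Meaning

end Literature.NumberTheory.FaltingsSerre.GSp4F2.ExtS3wrS2
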